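import Summits.Ventures.PackingBounds.SphericalCodes.DimFourThirdExact
import Summits.Ventures.PackingBounds.Configurations.CodeThird3
import Summits.Ventures.PackingBounds.Configurations.CodesThirdE7E6
import Summits.Ventures.PackingBounds.Configurations.CodesThirdConsA
import Summits.Ventures.PackingBounds.Configurations.Dim7Card56
import Summits.Ventures.PackingBounds.ThreePointCert.C6Td11Proof
import Summits.Ventures.PackingBounds.ThreePointCert.C9EProof

/-!
# How many unit spheres can touch two touching unit spheres? (SPLAG Table 9.2, all dimensions)

Framing: lottery ticket; floor = certified bounds/negative ranges. Venture `PackingBounds` (cell `pub-packcert`),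
spherical-codes family, standard-angle column `s = 1/3`.

Conway–Sloane, *SPLAG* Ch. 9 Table 9.2 tabulates bounds on `A(n, cos⁻¹ 1/3)` under the heading 'How many spheres can touch
two spheres?': if unit spheres of `ℝⁿ⁺¹` with pairwise disjoint interiors all touch two touching unit spheres (centres `a`, `b`
with `‖a - b‖ = 2`; a touching sphere has centre `c` with `‖c - a‖ = ‖c - b‖ = 2`; disjoint interiors: `‖c - c'‖ ≥ 2`), then
`c ↦ (c - (a + b)/2)/√3` maps the centres to unit vectors of the hyperplane `(a - b)ᗮ ≅ ℝⁿ` with pairwise inner products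
`≤ 1/3`, and conversely. This file proves that dictionary ONCE FOR ALL `n` (both directions, `touching_two_spheres_le_of_code_bound`,
`exists_touching_two_spheres_of_code`, and the transfer of brackets / exact values, `touching_two_spheres_bracket`,
`touching_two_spheres_isGreatest`) and then reads the cell's kernel-checked `s = 1/3` column in the language of the table,
one theorem per ambient dimension `ℝ⁴ … ℝ¹¹` (`n = 3 … 10`):

| ambient | `n` | in the kernel | sources (tree) |
|---|---|---|---|
| `ℝ⁴` | 3 | exactly `9` | `Config.CodeThird3.code_dim3_third_exact` |
| `ℝ⁵` | 4 | exactly `14` | `SphericalCodes.code_dim4_third_isGreatest` (`DimFourThirdExact`) |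
| `ℝ⁶` | 5 | `20 ≤ · ≤ 23` | `Config.CodeThird5.code_dim5_third_bracket` (E₆ section; three-point `C5T`) |
| `ℝ⁷` | 6 | `32 ≤ · ≤ 34` | `Config.CodeThird6.exists_code_32` (E₇ section) + three-point `C6Td11` |
| `ℝ⁸` | 7 | exactly `56` | `Config.Dim7Card56.code_isGreatest` (E₇ code; LP-sharp) |
| `ℝ⁹` | 8 | `64 ≤ · ≤ 74` | `Config.ConsA.code_dim8_third_bracket` (Construction A; three-point `C8T`) |
| `ℝ¹⁰` | 9 | `96 ≤ · ≤ 98` | `Config.ConsA.exists_code_third_96` + three-point equality case `C9E` |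
| `ℝ¹¹` | 10 | `104 ≤ · ≤ 135` | `Config.ConsA.code_dim10_third_bracket` (three-point `C10T`) |

All statements use Mathlib notions only (no cell-defined predicate).

## References
* J. H. Conway, N. J. A. Sloane, *Sphere Packings, Lattices and Groups*, 3rd ed., Springer 1999, Ch. 9 Table 9.2 and
  Ch. 1 §2.3. [`ConwaySloane1999`]
* C. Bachoc, F. Vallentin, New upper bounds for kissing numbers from semidefinite programming, J. Amer. Math. Soc. 21 (2008),
  Theorem 4.2 / Table 5.2. [`BachocVallentin2007`]
-/

noncomputable section

open Finset
open scoped RealInnerProductSpace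

namespace Summit.Ventures.PackingBounds.SphericalCodes

/-! ## The dictionary, for every `n` -/

/-- **Upper transfer.** If every code of unit vectors of `ℝⁿ` with pairwise inner products `≤ 1/3` has at most `N` points, then
at most `N` unit spheres of `ℝⁿ⁺¹` with pairwise disjoint interiors can touch two touching unit spheres.
[cite: ConwaySloane1999, Ch. 9 Table 9.2] -/
theorem touching_two_spheres_le_of_code_bound {n N : ℕ}
    (hN : ∀ C : Finset (EuclideanSpace ℝ (Fin n)), (∀ x ∈ C, ‖x‖ = 1) →
      (∀ x ∈ C, ∀ y ∈ C, x ≠ y → inner ℝ x y ≤ 1 / 3) → C.card ≤ N)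
    (a b : EuclideanSpace ℝ (Fin (n + 1))) (hab : ‖a - b‖ = 2) (S : Finset (EuclideanSpace ℝ (Fin (n + 1))))
    (ha : ∀ c ∈ S, ‖c - a‖ = 2) (hb : ∀ c ∈ S, ‖c - b‖ = 2)
    (hS : ∀ c ∈ S, ∀ c' ∈ S, c ≠ c' → 2 ≤ ‖c - c'‖) :
    S.card ≤ N := by
  set u : EuclideanSpace ℝ (Fin (n + 1)) := a - b with hu
  set m : EuclideanSpace ℝ (Fin (n + 1)) := (1 / 2 : ℝ) • (a + b) with hm
  have hu0 : u ≠ 0 := by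
    intro h; rw [h, norm_zero] at hab; norm_num at hab
  have huu : inner ℝ u u = (4 : ℝ) := by
    rw [real_inner_self_eq_norm_sq, hab]; norm_num
  -- the normalised, centred points
  set f : EuclideanSpace ℝ (Fin (n + 1)) → EuclideanSpace ℝ (Fin (n + 1)) := fun c => (1 / Real.sqrt 3) • (c - m) with hf
  have key : ∀ c ∈ S, inner ℝ u (c - m) = 0 ∧ inner ℝ (c - m) (c - m) = (3 : ℝ) := by
    intro c hc
    have h1 : inner ℝ (c - a) (c - a) = (4 : ℝ) := by rw [real_inner_self_eq_norm_sq, ha c hc]; norm_num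
    have h2 : inner ℝ (c - b) (c - b) = (4 : ℝ) := by rw [real_inner_self_eq_norm_sq, hb c hc]; norm_num
    have e1 : c - a = (c - m) - (1 / 2 : ℝ) • u := by
      rw [hm, hu]; ext i; simp; ring
    have e2 : c - b = (c - m) + (1 / 2 : ℝ) • u := by
      rw [hm, hu]; ext i; simp; ring
    rw [e1] at h1; rw [e2] at h2
    exact inner_aux_touch (c - m) u huu h1 h2
  have hfn : ∀ c ∈ S, ‖f c‖ = 1 := by
    intro c hc
    have h3 : (0 : ℝ) < Real.sqrt 3 := Real.sqrt_pos.mpr (by norm_num)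
    have hn : ‖c - m‖ = Real.sqrt 3 := by
      have := (key c hc).2
      rw [real_inner_self_eq_norm_sq] at this
      rw [← Real.sqrt_sq (norm_nonneg (c - m)), this]
    rw [hf]; simp only []
    rw [norm_smul, hn, Real.norm_eq_abs, abs_of_pos (by positivity)]
    field_simp
  have hfo : ∀ x ∈ S.image f, inner ℝ u x = 0 := by
    intro x hx
    obtain ⟨c, hc, rfl⟩ := mem_image.mp hx
    rw [hf]; simp only []
    rw [real_inner_smul_right, (key c hc).1, mul_zero]
  have hfi : ∀ c ∈ S, ∀ c' ∈ S, c ≠ c' → inner ℝ (f c) (f c') ≤ 1 / 3 := by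
    intro c hc c' hc' hne
    have hd : (4 : ℝ) ≤ inner ℝ ((c - m) - (c' - m)) ((c - m) - (c' - m)) := by
      have e : (c - m) - (c' - m) = c - c' := by abel
      rw [e, real_inner_self_eq_norm_sq]
      have := hS c hc c' hc' hne
      nlinarith [norm_nonneg (c - c')]
    have hcc : inner ℝ (c - m) (c' - m) ≤ 1 := inner_aux_sep _ _ (key c hc).2 (key c' hc').2 hd
    rw [hf]; simp only []
    rw [real_inner_smul_left, real_inner_smul_right]
    have h3 : (1 / Real.sqrt 3) * (1 / Real.sqrt 3) = 1 / 3 := by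
      rw [div_mul_div_comm, one_mul, Real.mul_self_sqrt (by norm_num : (0 : ℝ) ≤ 3)]
    rw [← mul_assoc, h3]
    linarith
  have hinj : Set.InjOn f S := by
    intro c hc c' hc' he
    by_contra hne
    have h := hfi c hc c' hc' hne
    rw [he, real_inner_self_eq_norm_sq, hfn c' hc'] at h
    norm_num at h
  -- transfer to ℝⁿ
  obtain ⟨C', hcard, hno, hin, -⟩ := Config.exists_transfer_orthogonal_singleton (n := n) u hu0 (S.image f) hfo
  have h1' : ∀ x ∈ C', ‖x‖ = 1 := by
    intro x hx
    obtain ⟨y, hy, he⟩ := hno x hx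
    obtain ⟨c, hc, rfl⟩ := mem_image.mp hy
    rw [he]; exact hfn c hc
  have h2' : ∀ x ∈ C', ∀ y ∈ C', x ≠ y → inner ℝ x y ≤ 1 / 3 := by
    intro x hx y hy hne
    obtain ⟨x0, hx0, y0, hy0, hne0, he⟩ := hin x hx y hy hne
    obtain ⟨c, hc, rfl⟩ := mem_image.mp hx0
    obtain ⟨c', hc', rfl⟩ := mem_image.mp hy0
    rw [he]
    exact hfi c hc c' hc' (fun h => hne0 (by rw [h]))
  have := hN C' h1' h2'
  rw [hcard, card_image_of_injOn hinj] at this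
  exact this

/-- The coordinate embedding `ι : ℝⁿ → ℝⁿ⁺¹`, `x ↦ (0, x₀, …, xₙ₋₁)`: it preserves inner products, commutes with differences,
and its image is orthogonal to `e₀`. -/
theorem exists_embed_succ (n : ℕ) :
    ∃ ι : EuclideanSpace ℝ (Fin n) → EuclideanSpace ℝ (Fin (n + 1)),
      (∀ x y, inner ℝ (ι x) (ι y) = inner ℝ x y) ∧ (∀ x y, ι x - ι y = ι (x - y)) ∧
        ∀ x, inner ℝ (EuclideanSpace.single (0 : Fin (n + 1)) (1 : ℝ)) (ι x) = 0 := by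
  have hco : ∀ x : EuclideanSpace ℝ (Fin n),
      WithLp.ofLp ((WithLp.equiv 2 (Fin (n + 1) → ℝ)).symm (Fin.cons (0 : ℝ) (WithLp.equiv 2 (Fin n → ℝ) x))) =
        Fin.cons (0 : ℝ) (WithLp.ofLp x) := fun x => by simp
  refine ⟨fun x => (WithLp.equiv 2 (Fin (n + 1) → ℝ)).symm (Fin.cons (0 : ℝ) (WithLp.equiv 2 (Fin n → ℝ) x)),
    fun x y => ?_, fun x y => ?_, fun x => ?_⟩
  · simp only [EuclideanSpace.inner_eq_star_dotProduct, dotProduct, star_trivial, Pi.star_apply, hco]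
    rw [Fin.sum_univ_succ]
    simp only [Fin.cons_zero, Fin.cons_succ, mul_zero, zero_add]
  · apply (WithLp.ofLp_injective (p := 2)).eq_iff.mp
    rw [WithLp.ofLp_sub, hco, hco, hco, WithLp.ofLp_sub]
    ext j
    refine Fin.cases ?_ (fun i => ?_) j
    · simp
    · simp
  · rw [EuclideanSpace.inner_single_left]
    simp

/-- **Lower transfer.** A code `C` of unit vectors of `ℝⁿ` with pairwise inner products `≤ 1/3` yields `C.card` unit spheres of
`ℝⁿ⁺¹` with pairwise disjoint interiors all touching the two touching unit spheres centred at `2e₀` and `0`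
(centres `e₀ + √3 · ι(x)`, `x ∈ C`). [cite: ConwaySloane1999, Ch. 9 Table 9.2] -/
theorem exists_touching_two_spheres_of_code {n : ℕ} (C : Finset (EuclideanSpace ℝ (Fin n)))
    (h1 : ∀ x ∈ C, ‖x‖ = 1) (h2 : ∀ x ∈ C, ∀ y ∈ C, x ≠ y → inner ℝ x y ≤ 1 / 3) :
    ∃ a b : EuclideanSpace ℝ (Fin (n + 1)), ‖a - b‖ = 2 ∧ ∃ S : Finset (EuclideanSpace ℝ (Fin (n + 1))),
      S.card = C.card ∧ (∀ c ∈ S, ‖c - a‖ = 2) ∧ (∀ c ∈ S, ‖c - b‖ = 2) ∧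
        (∀ c ∈ S, ∀ c' ∈ S, c ≠ c' → 2 ≤ ‖c - c'‖) := by
  obtain ⟨embed, inner_embed, embed_sub, inner_single_zero_embed⟩ := exists_embed_succ n
  set e : EuclideanSpace ℝ (Fin (n + 1)) := EuclideanSpace.single (0 : Fin (n + 1)) (1 : ℝ) with he
  have he1 : ‖e‖ = 1 := by rw [he, PiLp.norm_single, norm_one]
  have hee : inner ℝ e e = (1 : ℝ) := by rw [real_inner_self_eq_norm_sq, he1]; norm_num
  set g : EuclideanSpace ℝ (Fin n) → EuclideanSpace ℝ (Fin (n + 1)) := fun x => e + Real.sqrt 3 • embed x with hg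
  have h3 : Real.sqrt 3 * Real.sqrt 3 = 3 := Real.mul_self_sqrt (by norm_num)
  have hio : ∀ x : EuclideanSpace ℝ (Fin n), inner ℝ e (embed x) = 0 := fun x => inner_single_zero_embed x
  -- squared distances
  have hga : ∀ x ∈ C, ‖g x - (2 : ℝ) • e‖ = 2 := by
    intro x hx
    have hx1 : inner ℝ (embed x) (embed x) = 1 := by rw [inner_embed, real_inner_self_eq_norm_sq, h1 x hx]; norm_num
    have e1 : g x - (2 : ℝ) • e = Real.sqrt 3 • embed x - e := by rw [hg]; simp only []; module
    have hsq : inner ℝ (g x - (2 : ℝ) • e) (g x - (2 : ℝ) • e) = 4 := by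
      rw [e1]
      simp only [inner_sub_left, inner_sub_right, real_inner_smul_left, real_inner_smul_right, hio, hee, hx1,
        real_inner_comm e (embed x)]
      nlinarith [h3]
    rw [← Real.sqrt_sq (norm_nonneg _), ← real_inner_self_eq_norm_sq, hsq,
      show (4 : ℝ) = 2 ^ 2 by norm_num, Real.sqrt_sq (by norm_num : (0 : ℝ) ≤ 2)]
  have hgb : ∀ x ∈ C, ‖g x - 0‖ = 2 := by
    intro x hx
    have hx1 : inner ℝ (embed x) (embed x) = 1 := by rw [inner_embed, real_inner_self_eq_norm_sq, h1 x hx]; norm_num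
    have hsq : inner ℝ (g x) (g x) = 4 := by
      rw [hg]; simp only []
      simp only [inner_add_left, inner_add_right, real_inner_smul_left, real_inner_smul_right, hio, hee, hx1,
        real_inner_comm e (embed x)]
      nlinarith [h3]
    rw [sub_zero, ← Real.sqrt_sq (norm_nonneg _), ← real_inner_self_eq_norm_sq, hsq,
      show (4 : ℝ) = 2 ^ 2 by norm_num, Real.sqrt_sq (by norm_num : (0 : ℝ) ≤ 2)]
  have hgg : ∀ x ∈ C, ∀ y ∈ C, x ≠ y → 2 ≤ ‖g x - g y‖ := by
    intro x hx y hy hxy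
    have hx1 : inner ℝ x x = 1 := by rw [real_inner_self_eq_norm_sq, h1 x hx]; norm_num
    have hy1 : inner ℝ y y = 1 := by rw [real_inner_self_eq_norm_sq, h1 y hy]; norm_num
    have hxy' := h2 x hx y hy hxy
    have e1 : g x - g y = Real.sqrt 3 • embed (x - y) := by
      rw [hg]; simp only []; rw [← embed_sub]; module
    have hsq : 4 ≤ inner ℝ (g x - g y) (g x - g y) := by
      rw [e1, real_inner_smul_left, real_inner_smul_right, inner_embed]
      simp only [inner_sub_left, inner_sub_right, hx1, hy1, real_inner_comm x y]
      nlinarith [h3]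
    rw [real_inner_self_eq_norm_sq] at hsq
    nlinarith [norm_nonneg (g x - g y)]
  have hginj : Set.InjOn g C := by
    intro x hx y hy hexy
    by_contra hne
    have := hgg x hx y hy hne
    rw [hexy, sub_self, norm_zero] at this; norm_num at this
  refine ⟨(2 : ℝ) • e, 0, ?_, C.image g, ?_, ?_, ?_, ?_⟩
  · rw [sub_zero, norm_smul, he1, Real.norm_eq_abs]; norm_num
  · rw [card_image_of_injOn hginj]
  · intro c hc'; obtain ⟨x, hx, rfl⟩ := mem_image.mp hc'; exact hga x hx
  · intro c hc'; obtain ⟨x, hx, rfl⟩ := mem_image.mp hc'; exact hgb x hx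
  · intro c hc' c' hc'' hne
    obtain ⟨x, hx, rfl⟩ := mem_image.mp hc'
    obtain ⟨y, hy, rfl⟩ := mem_image.mp hc''
    exact hgg x hx y hy (fun h => hne (by rw [h]))

/-- **Bracket transfer.** A bracket `L ≤ A(n, arccos 1/3) ≤ U` in the kernel (an explicit `L`-point code and a bound `U` for all
codes) gives the same bracket for the number of non-overlapping unit spheres of `ℝⁿ⁺¹` touching two touching unit spheres.
[cite: ConwaySloane1999, Ch. 9 Table 9.2] -/
theorem touching_two_spheres_bracket {n L U : ℕ}
    (h : (∃ C : Finset (EuclideanSpace ℝ (Fin n)), C.card = L ∧ (∀ x ∈ C, ‖x‖ = 1) ∧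
        (∀ x ∈ C, ∀ y ∈ C, x ≠ y → inner ℝ x y ≤ 1 / 3)) ∧
      ∀ C : Finset (EuclideanSpace ℝ (Fin n)), (∀ x ∈ C, ‖x‖ = 1) →
        (∀ x ∈ C, ∀ y ∈ C, x ≠ y → inner ℝ x y ≤ 1 / 3) → C.card ≤ U) :
    (∃ a b : EuclideanSpace ℝ (Fin (n + 1)), ‖a - b‖ = 2 ∧ ∃ S : Finset (EuclideanSpace ℝ (Fin (n + 1))),
      S.card = L ∧ (∀ c ∈ S, ‖c - a‖ = 2) ∧ (∀ c ∈ S, ‖c - b‖ = 2) ∧ (∀ c ∈ S, ∀ c' ∈ S, c ≠ c' → 2 ≤ ‖c - c'‖)) ∧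
    ∀ a b : EuclideanSpace ℝ (Fin (n + 1)), ‖a - b‖ = 2 → ∀ S : Finset (EuclideanSpace ℝ (Fin (n + 1))),
      (∀ c ∈ S, ‖c - a‖ = 2) → (∀ c ∈ S, ‖c - b‖ = 2) → (∀ c ∈ S, ∀ c' ∈ S, c ≠ c' → 2 ≤ ‖c - c'‖) →
        S.card ≤ U := by
  obtain ⟨⟨C, hc, h1, h2⟩, hU⟩ := h
  refine ⟨?_, fun a b hab S ha hb hS => touching_two_spheres_le_of_code_bound hU a b hab S ha hb hS⟩
  obtain ⟨a, b, hab, S, hS, ha, hb, hsep⟩ := exists_touching_two_spheres_of_code C h1 h2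
  exact ⟨a, b, hab, S, hS.trans hc, ha, hb, hsep⟩

/-- **Exact-value transfer.** If `N` is the largest size of a code of unit vectors of `ℝⁿ` with pairwise inner products `≤ 1/3`
(`A(n, arccos 1/3) = N` as an `IsGreatest` statement), then `N` is the largest number of non-overlapping unit spheres of `ℝⁿ⁺¹`
that can touch two touching unit spheres. [cite: ConwaySloane1999, Ch. 9 Table 9.2] -/
theorem touching_two_spheres_isGreatest {n N : ℕ}
    (h : IsGreatest {M : ℕ | ∃ C : Finset (EuclideanSpace ℝ (Fin n)), C.card = M ∧ (∀ x ∈ C, ‖x‖ = 1) ∧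
        (∀ x ∈ C, ∀ y ∈ C, x ≠ y → inner ℝ x y ≤ 1 / 3)} N) :
    IsGreatest {M : ℕ | ∃ a b : EuclideanSpace ℝ (Fin (n + 1)), ‖a - b‖ = 2 ∧
        ∃ S : Finset (EuclideanSpace ℝ (Fin (n + 1))), S.card = M ∧ (∀ c ∈ S, ‖c - a‖ = 2) ∧
          (∀ c ∈ S, ‖c - b‖ = 2) ∧ (∀ c ∈ S, ∀ c' ∈ S, c ≠ c' → 2 ≤ ‖c - c'‖)} N := by
  have hU : ∀ C : Finset (EuclideanSpace ℝ (Fin n)), (∀ x ∈ C, ‖x‖ = 1) →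
      (∀ x ∈ C, ∀ y ∈ C, x ≠ y → inner ℝ x y ≤ 1 / 3) → C.card ≤ N :=
    fun C h1 h2 => h.2 ⟨C, rfl, h1, h2⟩
  obtain ⟨hL, hle⟩ := touching_two_spheres_bracket (n := n) (L := N) (U := N) ⟨h.1, hU⟩
  refine ⟨hL, ?_⟩
  rintro M ⟨a, b, hab, S, rfl, ha, hb, hS⟩
  exact hle a b hab S ha hb hS

/-! ## The table, row by row (`ℝ⁴ … ℝ¹¹`) -/

/-- **`ℝ⁴`: exactly `9`** unit spheres can touch two touching unit spheres without overlapping (SPLAG Table 9.2, `n = 3`;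
kernel: `A(3, arccos 1/3) = 9`, `Config.CodeThird3.code_dim3_third_exact`). [cite: ConwaySloane1999, Ch. 9 Table 9.2] -/
theorem touching_two_spheres_dim4_isGreatest :
    IsGreatest {M : ℕ | ∃ a b : EuclideanSpace ℝ (Fin 4), ‖a - b‖ = 2 ∧
        ∃ S : Finset (EuclideanSpace ℝ (Fin 4)), S.card = M ∧ (∀ c ∈ S, ‖c - a‖ = 2) ∧
          (∀ c ∈ S, ‖c - b‖ = 2) ∧ (∀ c ∈ S, ∀ c' ∈ S, c ≠ c' → 2 ≤ ‖c - c'‖)} 9 :=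
  touching_two_spheres_isGreatest Config.CodeThird3.code_dim3_third_exact

/-- **`ℝ⁵`: exactly `14`** (SPLAG Table 9.2, `n = 4`, printed `14–15`; kernel: `A(4, arccos 1/3) = 14`,
`SphericalCodes.code_dim4_third_isGreatest` = the `[Mac0]` construction + the cell's three-point certificate `C4Td10`).
[cite: ConwaySloane1999, Ch. 9 Table 9.2] -/
theorem touching_two_spheres_dim5_isGreatest :
    IsGreatest {M : ℕ | ∃ a b : EuclideanSpace ℝ (Fin 5), ‖a - b‖ = 2 ∧
        ∃ S : Finset (EuclideanSpace ℝ (Fin 5)), S.card = M ∧ (∀ c ∈ S, ‖c - a‖ = 2) ∧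
          (∀ c ∈ S, ‖c - b‖ = 2) ∧ (∀ c ∈ S, ∀ c' ∈ S, c ≠ c' → 2 ≤ ‖c - c'‖)} 14 :=
  touching_two_spheres_isGreatest code_dim4_third_isGreatest

/-- **`ℝ⁶`: between `20` and `23`** (SPLAG Table 9.2, `n = 5`; kernel: the `E₆` section gives `20`, the cell's
three-point certificate `C5T` gives `≤ 23`). [cite: ConwaySloane1999, Ch. 9 Table 9.2] -/
theorem touching_two_spheres_dim6_bracket :
    (∃ a b : EuclideanSpace ℝ (Fin 6), ‖a - b‖ = 2 ∧ ∃ S : Finset (EuclideanSpace ℝ (Fin 6)),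
      S.card = 20 ∧ (∀ c ∈ S, ‖c - a‖ = 2) ∧ (∀ c ∈ S, ‖c - b‖ = 2) ∧ (∀ c ∈ S, ∀ c' ∈ S, c ≠ c' → 2 ≤ ‖c - c'‖)) ∧
    ∀ a b : EuclideanSpace ℝ (Fin 6), ‖a - b‖ = 2 → ∀ S : Finset (EuclideanSpace ℝ (Fin 6)),
      (∀ c ∈ S, ‖c - a‖ = 2) → (∀ c ∈ S, ‖c - b‖ = 2) → (∀ c ∈ S, ∀ c' ∈ S, c ≠ c' → 2 ≤ ‖c - c'‖) →
        S.card ≤ 23 :=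
  touching_two_spheres_bracket Config.CodeThird5.code_dim5_third_bracket

/-- **`ℝ⁷`: between `32` and `34`** (SPLAG Table 9.2, `n = 6`; Bachoc–Vallentin Table 5.2: `32–35`, 'previously `37`'; kernel: the `E₇` section
gives `32`, the cell's degree-`11` three-point certificate `C6Td11` gives `≤ 34`).
[cite: ConwaySloane1999, Ch. 9 Table 9.2] [cite: BachocVallentin2007, Table 5.2] -/
theorem touching_two_spheres_dim7_bracket :
    (∃ a b : EuclideanSpace ℝ (Fin 7), ‖a - b‖ = 2 ∧ ∃ S : Finset (EuclideanSpace ℝ (Fin 7)),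
      S.card = 32 ∧ (∀ c ∈ S, ‖c - a‖ = 2) ∧ (∀ c ∈ S, ‖c - b‖ = 2) ∧ (∀ c ∈ S, ∀ c' ∈ S, c ≠ c' → 2 ≤ ‖c - c'‖)) ∧
    ∀ a b : EuclideanSpace ℝ (Fin 7), ‖a - b‖ = 2 → ∀ S : Finset (EuclideanSpace ℝ (Fin 7)),
      (∀ c ∈ S, ‖c - a‖ = 2) → (∀ c ∈ S, ‖c - b‖ = 2) → (∀ c ∈ S, ∀ c' ∈ S, c ≠ c' → 2 ≤ ‖c - c'‖) →
        S.card ≤ 34 :=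
  touching_two_spheres_bracket ⟨Config.CodeThird6.exists_code_32, ThreePointCert.C6Td11.code_dim6_third_le_34_sdp⟩

/-- **`ℝ⁸`: exactly `56`** (SPLAG Table 9.2, `n = 7`; kernel: `A(7, arccos 1/3) = 56`, `Config.Dim7Card56.code_isGreatest` =
the `E₇` code + the LP-sharp Levenshtein bound). [cite: ConwaySloane1999, Ch. 9 Table 9.2] -/
theorem touching_two_spheres_dim8_isGreatest :
    IsGreatest {M : ℕ | ∃ a b : EuclideanSpace ℝ (Fin 8), ‖a - b‖ = 2 ∧
        ∃ S : Finset (EuclideanSpace ℝ (Fin 8)), S.card = M ∧ (∀ c ∈ S, ‖c - a‖ = 2) ∧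
          (∀ c ∈ S, ‖c - b‖ = 2) ∧ (∀ c ∈ S, ∀ c' ∈ S, c ≠ c' → 2 ≤ ‖c - c'‖)} 56 :=
  touching_two_spheres_isGreatest Config.Dim7Card56.code_isGreatest

/-- **`ℝ⁹`: between `64` and `74`** (SPLAG Table 9.2, `n = 8`; kernel: Construction A gives `64`, the cell's
three-point certificate `C8T` gives `≤ 74`). [cite: ConwaySloane1999, Ch. 9 Table 9.2] -/
theorem touching_two_spheres_dim9_bracket :
    (∃ a b : EuclideanSpace ℝ (Fin 9), ‖a - b‖ = 2 ∧ ∃ S : Finset (EuclideanSpace ℝ (Fin 9)),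
      S.card = 64 ∧ (∀ c ∈ S, ‖c - a‖ = 2) ∧ (∀ c ∈ S, ‖c - b‖ = 2) ∧ (∀ c ∈ S, ∀ c' ∈ S, c ≠ c' → 2 ≤ ‖c - c'‖)) ∧
    ∀ a b : EuclideanSpace ℝ (Fin 9), ‖a - b‖ = 2 → ∀ S : Finset (EuclideanSpace ℝ (Fin 9)),
      (∀ c ∈ S, ‖c - a‖ = 2) → (∀ c ∈ S, ‖c - b‖ = 2) → (∀ c ∈ S, ∀ c' ∈ S, c ≠ c' → 2 ≤ ‖c - c'‖) →
        S.card ≤ 74 :=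
  touching_two_spheres_bracket Config.ConsA.code_dim8_third_bracket

/-- **`ℝ¹⁰`: between `96` and `98`** (SPLAG Table 9.2, `n = 9`, printed upper bound `107` from [Ass1]; kernel: Construction A gives `96`, the cell's
three-point certificate with the equality-case exclusion `C9E` gives `≤ 98`). [cite: ConwaySloane1999, Ch. 9 Table 9.2] -/
theorem touching_two_spheres_dim10_bracket :
    (∃ a b : EuclideanSpace ℝ (Fin 10), ‖a - b‖ = 2 ∧ ∃ S : Finset (EuclideanSpace ℝ (Fin 10)),
      S.card = 96 ∧ (∀ c ∈ S, ‖c - a‖ = 2) ∧ (∀ c ∈ S, ‖c - b‖ = 2) ∧ (∀ c ∈ S, ∀ c' ∈ S, c ≠ c' → 2 ≤ ‖c - c'‖)) ∧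
    ∀ a b : EuclideanSpace ℝ (Fin 10), ‖a - b‖ = 2 → ∀ S : Finset (EuclideanSpace ℝ (Fin 10)),
      (∀ c ∈ S, ‖c - a‖ = 2) → (∀ c ∈ S, ‖c - b‖ = 2) → (∀ c ∈ S, ∀ c' ∈ S, c ≠ c' → 2 ≤ ‖c - c'‖) →
        S.card ≤ 98 :=
  touching_two_spheres_bracket ⟨Config.ConsA.exists_code_third_96, ThreePointCert.C9E.code_dim9_third_le_98⟩

/-- **`ℝ¹¹`: between `104` and `135`** (SPLAG Table 9.2, `n = 10`; kernel: Construction A gives `104`, the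
cell's three-point certificate `C10T` gives `≤ 135`). [cite: ConwaySloane1999, Ch. 9 Table 9.2] -/
theorem touching_two_spheres_dim11_bracket :
    (∃ a b : EuclideanSpace ℝ (Fin 11), ‖a - b‖ = 2 ∧ ∃ S : Finset (EuclideanSpace ℝ (Fin 11)),
      S.card = 104 ∧ (∀ c ∈ S, ‖c - a‖ = 2) ∧ (∀ c ∈ S, ‖c - b‖ = 2) ∧ (∀ c ∈ S, ∀ c' ∈ S, c ≠ c' → 2 ≤ ‖c - c'‖)) ∧
    ∀ a b : EuclideanSpace ℝ (Fin 11), ‖a - b‖ = 2 → ∀ S : Finset (EuclideanSpace ℝ (Fin 11)),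
      (∀ c ∈ S, ‖c - a‖ = 2) → (∀ c ∈ S, ‖c - b‖ = 2) → (∀ c ∈ S, ∀ c' ∈ S, c ≠ c' → 2 ≤ ‖c - c'‖) →
        S.card ≤ 135 :=
  touching_two_spheres_bracket Config.ConsA.code_dim10_third_bracket

end Summit.Ventures.PackingBounds.SphericalCodes
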